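import Summits.Ventures.HSemireg.LeadingDigitRemainder
import Summits.Ventures.HSemireg.TwoVectorDividedPowers
import Summits.Ventures.HSemireg.EdgeUnitClosedForms
import Summits.Ventures.HSemireg.DimZeroClosedForms

/-!
# LEMMA F: the dimension-0 `E = ∅` units (types (2,2,2,2,3,4) and (2,2,2,2,2,5)) are CLASS-DEAD (pub-hsemireg, S4-PUSH corner 2)

Kernel leg of seat s4-search-2 gen 16 (cell `pub-hsemireg`); companion of `EdgeUnitClassDead.lean` (ROW J),
`MixedFrameClassDead.lean` (ROW K), `CliqueUnitsClassDead.lean` (ROW L2) and `LemmaCFrameClassDead.lean` (ROW M) for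
the LAST unit family of the M2 cell that was machine-only of record: the 89 «dimension-0» `E = ∅` class-units of the
dual types `(2⁴,3,4)` and `(2⁵,5)` (`s4push/search-2/g11/LIFT2-search-2-g11.md` §0 ∕ §5: «affine dim 0, the one digit
dies by (V)», machine ×2 — g10 and lift2 — with NO pencil lemma).  This file (ROW N2) supplies the pencil lemma (LEMMA F
below) and proves it in Mathlib's `ExteriorAlgebra ℤ M` for the type (2,2,2,2,3,4); ROW N3 `DimZeroUnitsClassDeadFive.lean`
is the type (2,2,2,2,2,5); the ring identities are ROW N1 `DimZeroClosedForms.lean`.  Imports: only the rows used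
mathematically (`LeadingDigitRemainder`, `TwoVectorDividedPowers`, `EdgeUnitClosedForms`, N1) — not ROW J.

Setting (as in ROWS J ∕ K ∕ M).  `M` free with basis `x : Fin 12`, slots `hᵢ = ι x₂ᵢ · ι x₂ᵢ₊₁`; the type is
`D = 4(h₀ + h₁ + h₂ + h₃) + 8h₄ + 16h₅` (c′ = (2,2,2,2,3,4)) resp. `D = 4(h₀ + ⋯ + h₄) + 32h₅` (c′ = (2,2,2,2,2,5)) with
its INTRINSIC divided powers `D₂, D₃, D₄` (`D·D = 2D₂`, `D·D·D = 6D₃`, `D·D·D·D = 24D₄` — no closed form is assumed;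
ROW N1 `DimZeroClosedForms` proves the closed forms); a signature with `σ₁ = 0`, `σ₂ = 4t + 2`, `σ₃ = 4u`,
`σ₄ = 8w + 4` (`t, u, w, σ₀` ANY elements — for the classes of record `v₂(σ₂) = 1`, `v₂(σ₃) = 2`, `v₂(σ₄) = 2`, `σ₀` odd, read in `ℤ₍₂₎`); the leading
digit of an `E = ∅` unit is a 2-form of rank `≤ 2`, i.e. `β = ι a · ι b` for ANY `a, b ∈ M`; ANY `X` in the span of the
2-vectors; the class 2-form `B = β + 2X` with intrinsic divided powers `B₂, B₃, B₄`; the registered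
`T₃ = σ₃D₃ − 4σ₂D₂B + 16σ₁DB₂ − 64σ₀B₃` and `T₄ = σ₄D₄ − 4σ₃D₃B + 16σ₂D₂B₂ − 64σ₁DB₃ + 256σ₀B₄` of CRITERION L
(targets `2^{m(2k−1)}`: `2¹⁰` at `k = 3`, `2¹⁴` at `k = 4`).

**LEMMA F (pencil, this file; replaces the machine's route «k = 3, 5 linear ⇒ X̄₀ = 0, then (V)»).**  Write
`P = Σ_{c′ᵢ = 2} hᵢ` and `P^[j]` for its elementary symmetric functions.  (F1) `T₃(B) = −128·P^[2]β + 256·W₃`, so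
CRITERION L at `k = 3` forces `P^[2]·β ∈ 2Λ`.  (F2) Given that, `T₄(B) = 1024·P^[4] + 2048·W₄` (the terms
`u·P^[3]β` and `P^[2]β·X` are even because `3P^[3] = P·P^[2]`, and `256·B₄ ∈ 2048Λ` because `3B₄ = 8(βXX₂ + X₂²)`), and
`P^[4] ∉ 2Λ` — its coefficient at `x₀ ∧ ⋯ ∧ x₇` is `1` — so `T₄(B) ≢ 0 mod 2¹¹`, let alone `2¹⁴`.  HENCE CRITERION L fails
at `k = 3` or at `k = 4` for every completion of every leading digit of rank `≤ 2`: the 63 + 26 classes are CLASS-DEAD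
(`classDead_c222234` here, `DimZeroUnitsClassDeadFive.classDead_c222225` in ROW N3), one kernel theorem per type.  Tools: the divided-power binomial laws of
`EdgeUnitClosedForms`, the divided powers of `TwoVectorDividedPowers`, torsion-freeness
(`LeadingDigitRemainder.natCast_mul_cancel`) and ONE integer-valued coefficient functional of degree 8
(`TwoAdicReadings.exists_topCoeff`); the commutative ring is the 2-vector subalgebra `Λ` (`TwoSlotGlue`).

Scope ∕ honest framing as in ROW J: CLASS-LEVEL statements for ONE family of units of a NECESSARY-condition sieve
(CRITERION L) at the special fibre `E⁶`; that the leading digits of these units are the 2-forms of rank `≤ 2`, that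
CRITERION L is the registered necessary condition, the signature table (in particular `v₂(σ₄) = 2` on these classes)
and the census (63 + 26 = 89 class-units) are framework words; theorems only (count-neutral, no `def`); no object, no
`σ` computation, no Hodge statement; nothing here bears on HC ∕ HC_CM ∕ HC_AV.
-/

namespace Summit.Ventures.HSemireg.DimZeroUnitsClassDead

open ExteriorAlgebra TwoSlotFrameTable DividedSquareLemma TwoAdicReadings LeadingDigitRemainder
  TwoVectorDividedPowers EdgeUnitClosedForms DimZeroClosedForms
open scoped IsMulCommutative

section Cancel

/-! ### 1. Small tools: numerals of `Λ`, cancellation -/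

variable {M : Type*} [AddCommGroup M] [Module ℤ M]

/-- Numerals of a subalgebra coerce to numerals (used after `push_cast` on identities transported from `Λ`). -/
theorem val_ofNat (S : Subalgebra ℤ (ExteriorAlgebra ℤ M)) (n : ℕ) [n.AtLeastTwo] :
    ((no_index (OfNat.ofNat n) : S) : ExteriorAlgebra ℤ M) = OfNat.ofNat n := rfl

/-- Cancelling `2` (torsion-freeness, `LeadingDigitRemainder.natCast_mul_cancel`; a `private` local helper — the same
statement is landed as `MixedFrameClassDead.cancel_two` — so that this file depends only on the rows it uses mathematically:
`LeadingDigitRemainder`, `TwoVectorDividedPowers`, `EdgeUnitClosedForms`, N1). -/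
private theorem cancel_2 (x : Module.Basis (Fin 12) ℤ M) {Q Q' : ExteriorAlgebra ℤ M}
    (h : (2 : ExteriorAlgebra ℤ M) * Q = 2 * Q') : Q = Q' :=
  natCast_mul_cancel x 2 (by norm_num) Q Q' (by exact_mod_cast h)

/-- Cancelling `6` (`private` local helper; ROW N3 carries its own private copy). -/
private theorem cancel_6 (x : Module.Basis (Fin 12) ℤ M) {Q Q' : ExteriorAlgebra ℤ M}
    (h : (6 : ExteriorAlgebra ℤ M) * Q = 6 * Q') : Q = Q' :=
  natCast_mul_cancel x 6 (by norm_num) Q Q' (by exact_mod_cast h)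

/-- Cancelling `8`. -/
theorem cancel_8 (x : Module.Basis (Fin 12) ℤ M) {Q Q' : ExteriorAlgebra ℤ M}
    (h : (8 : ExteriorAlgebra ℤ M) * Q = 8 * Q') : Q = Q' :=
  natCast_mul_cancel x 8 (by norm_num) Q Q' (by exact_mod_cast h)

/-- Cancelling `24`. -/
theorem cancel_24 (x : Module.Basis (Fin 12) ℤ M) {Q Q' : ExteriorAlgebra ℤ M}
    (h : (24 : ExteriorAlgebra ℤ M) * Q = 24 * Q') : Q = Q' :=
  natCast_mul_cancel x 24 (by norm_num) Q Q' (by exact_mod_cast h)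

/-- Cancelling `128`. -/
theorem cancel_128 (x : Module.Basis (Fin 12) ℤ M) {Q Q' : ExteriorAlgebra ℤ M}
    (h : (128 : ExteriorAlgebra ℤ M) * Q = 128 * Q') : Q = Q' :=
  natCast_mul_cancel x 128 (by norm_num) Q Q' (by exact_mod_cast h)

/-- Cancelling `1024`. -/
theorem cancel_1024 (x : Module.Basis (Fin 12) ℤ M) {Q Q' : ExteriorAlgebra ℤ M}
    (h : (1024 : ExteriorAlgebra ℤ M) * Q = 1024 * Q') : Q = Q' :=
  natCast_mul_cancel x 1024 (by norm_num) Q Q' (by exact_mod_cast h)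

end Cancel

section Reading

/-! ### 2. The reading: `P^[4]` is not twice anything -/

variable {M : Type*} [AddCommGroup M] [Module ℤ M]

/-- **`h₀h₁h₂h₃ = x₀ ∧ ⋯ ∧ x₇` is not twice anything** (the reading of LEMMA F): for a basis `x : Fin 12` of `M`,
`ι x₀ ι x₁ · ι x₂ ι x₃ · ι x₄ ι x₅ · ι x₆ ι x₇ ≠ 2·W` for every `W` in `ExteriorAlgebra ℤ M` — apply the
integer-valued functional `τ ∘ Λ(π)` (`π` the coordinates `0–7`, `τ` the top coefficient of `Λ(ℤ⁸)`): `1 = 2·τ(…)`. -/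
theorem P4_ne_two_mul (x : Module.Basis (Fin 12) ℤ M) (W : ExteriorAlgebra ℤ M) :
    ι ℤ (x 0) * ι ℤ (x 1) * (ι ℤ (x 2) * ι ℤ (x 3)) * (ι ℤ (x 4) * ι ℤ (x 5)) * (ι ℤ (x 6) * ι ℤ (x 7))
      ≠ 2 * W := by
  obtain ⟨τ, hτ⟩ := exists_topCoeff ℤ 8
  intro h
  have key := congrArg (fun z => τ (ExteriorAlgebra.map
    (LinearMap.funLeft ℤ ℤ (Fin.castLE (show 8 ≤ 12 by decide)) ∘ₗ (x.equivFun : M →ₗ[ℤ] (Fin 12 → ℤ))) z)) h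
  simp only [map_mul, map_apply_ι, projEight_basis, Matrix.cons_val, map_ofNat, mul_assoc] at key
  rw [prod_eight_eq_ιMulti, hτ, apply_ofNat_mul τ 2] at key
  have k2 : (1 : ℤ) = 2 * _ := key
  omega

/-- The same with a tail killed by the projection: `(h₀h₁h₂h₃ + N·(ι x₈ ι x₉)) ≠ 2·W` for any `N` —
the four extra terms of `P^[4]` on five slots all contain `h₄ = ι x₈ ι x₉`. -/
theorem P4_five_ne_two_mul (x : Module.Basis (Fin 12) ℤ M) (N W : ExteriorAlgebra ℤ M) :
    ι ℤ (x 0) * ι ℤ (x 1) * (ι ℤ (x 2) * ι ℤ (x 3)) * (ι ℤ (x 4) * ι ℤ (x 5)) * (ι ℤ (x 6) * ι ℤ (x 7))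
      + N * (ι ℤ (x 8) * ι ℤ (x 9)) ≠ 2 * W := by
  obtain ⟨τ, hτ⟩ := exists_topCoeff ℤ 8
  intro h
  have key := congrArg (fun z => τ (ExteriorAlgebra.map
    (LinearMap.funLeft ℤ ℤ (Fin.castLE (show 8 ≤ 12 by decide)) ∘ₗ (x.equivFun : M →ₗ[ℤ] (Fin 12 → ℤ))) z)) h
  simp only [map_add, map_mul, map_apply_ι, projEight_basis, Matrix.cons_val, map_ofNat, map_zero, mul_zero,
    add_zero, mul_assoc] at key
  rw [prod_eight_eq_ιMulti, hτ, apply_ofNat_mul τ 2] at key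
  have k2 : (1 : ℤ) = 2 * _ := key
  omega

end Reading

section DimZero

/-! ### 3. LEMMA F for the type (2,2,2,2,3,4) (the type (2,2,2,2,2,5) is ROW N3) -/

variable {M : Type*} [AddCommGroup M] [Module ℤ M]

set_option maxHeartbeats 800000 in
/-- **THE (2,2,2,2,3,4) UNITS ARE CLASS-DEAD (LEMMA F, 63 classes).**  For a free `ℤ`-module `M` with basis
`x : Fin 12` (slots `hᵢ = ι x₂ᵢ ι x₂ᵢ₊₁`), the type `D = 4(h₀ + h₁ + h₂ + h₃) + 8h₄ + 16h₅` with ANY `D₂, D₃, D₄` such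
that `D·D = 2D₂`, `D·D·D = 6D₃`, `D·D·D·D = 24D₄` (its intrinsic divided powers), a signature `σ₁ = 0`,
`σ₂ = 4t + 2`, `σ₃ = 4u`, `σ₄ = 8w + 4` (`t, u, w, σ₀` ANY elements), a leading digit `β = ι a · ι b` for ANY
`a, b ∈ M` (every 2-form of rank `≤ 2`), ANY `X` in the span of the 2-vectors, the class 2-form `B = ι a ι b + 2X` with
ANY `B₂, B₃, B₄` such that `B·B = 2B₂`, `B·B·B = 6B₃`, `B·B·B·B = 24B₄`, and the registered `T₃(B)`, `T₄(B)`: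
they are never simultaneously `= 1024·Z₃` and `= 16384·Z₄` (`Z₃, Z₄` arbitrary) — CRITERION L fails at `k = 3` or at
`k = 4` for every completion of every leading digit of rank `≤ 2`.  Every hypothesis is used; no closed form and no
table entry is assumed. -/
theorem classDead_c222234 (x : Module.Basis (Fin 12) ℤ M)
    (h₀ h₁ h₂ h₃ h₄ h₅ σ₀ σ₁ σ₂ σ₃ σ₄ t u w D D₂ D₃ D₄ X B B₂ B₃ B₄ T₃ T₄ : ExteriorAlgebra ℤ M) (a b : M)
    (hh₀ : h₀ = ι ℤ (x 0) * ι ℤ (x 1)) (hh₁ : h₁ = ι ℤ (x 2) * ι ℤ (x 3)) (hh₂ : h₂ = ι ℤ (x 4) * ι ℤ (x 5))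
    (hh₃ : h₃ = ι ℤ (x 6) * ι ℤ (x 7)) (hh₄ : h₄ = ι ℤ (x 8) * ι ℤ (x 9)) (hh₅ : h₅ = ι ℤ (x 10) * ι ℤ (x 11))
    (hD : D = 4 * (h₀ + h₁ + h₂ + h₃) + 8 * h₄ + 16 * h₅)
    (qD : D * D = 2 * D₂) (cD : D * D * D = 6 * D₃) (fD : D * D * D * D = 24 * D₄)
    (mX : X ∈ Submodule.span ℤ (Set.range fun p : M × M => ι ℤ p.1 * ι ℤ p.2))
    (hB : B = ι ℤ a * ι ℤ b + 2 * X) (qB : B * B = 2 * B₂) (cB : B * B * B = 6 * B₃)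
    (fB : B * B * B * B = 24 * B₄)
    (hσ₁ : σ₁ = 0) (hσ₂ : σ₂ = 4 * t + 2) (hσ₃ : σ₃ = 4 * u) (hσ₄ : σ₄ = 8 * w + 4)
    (hT₃ : T₃ = σ₃ * D₃ - 4 * σ₂ * (D₂ * B) + 16 * σ₁ * (D * B₂) - 64 * σ₀ * B₃)
    (hT₄ : T₄ = σ₄ * D₄ - 4 * σ₃ * (D₃ * B) + 16 * σ₂ * (D₂ * B₂) - 64 * σ₁ * (D * B₃) + 256 * σ₀ * B₄) :
    ∀ Z₃ Z₄ : ExteriorAlgebra ℤ M, ¬ (T₃ = 1024 * Z₃ ∧ T₄ = 16384 * Z₄) := by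
  rintro Z₃ Z₄ ⟨hcrit₃, hcrit₄⟩
  haveI := TwoSlotGlue.isMulCommutative_twoVectorSubalgebra (R := ℤ) (M := M)
  set Λ := Algebra.adjoin ℤ (Set.range fun p : M × M => ι ℤ p.1 * ι ℤ p.2) with hΛ
  -- names (opaque atoms with defining equations) for the leading digit and the closed forms
  obtain ⟨β, hβ⟩ : ∃ β : ExteriorAlgebra ℤ M, β = ι ℤ a * ι ℤ b := ⟨_, rfl⟩
  rw [← hβ] at hB
  obtain ⟨P, hP⟩ : ∃ P : ExteriorAlgebra ℤ M, P = h₀ + h₁ + h₂ + h₃ := ⟨_, rfl⟩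
  obtain ⟨P₂, hP₂⟩ : ∃ P₂ : ExteriorAlgebra ℤ M,
    P₂ = h₀ * h₁ + h₀ * h₂ + h₀ * h₃ + h₁ * h₂ + h₁ * h₃ + h₂ * h₃ := ⟨_, rfl⟩
  obtain ⟨P₃, hP₃⟩ : ∃ P₃ : ExteriorAlgebra ℤ M,
    P₃ = h₀ * h₁ * h₂ + h₀ * h₁ * h₃ + h₀ * h₂ * h₃ + h₁ * h₂ * h₃ := ⟨_, rfl⟩
  obtain ⟨P₄, hP₄⟩ : ∃ P₄ : ExteriorAlgebra ℤ M, P₄ = h₀ * h₁ * h₂ * h₃ := ⟨_, rfl⟩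
  obtain ⟨R₂, hR₂⟩ : ∃ R₂ : ExteriorAlgebra ℤ M, R₂ = P * h₄ + 2 * (P * h₅) + 4 * (h₄ * h₅) := ⟨_, rfl⟩
  obtain ⟨R₃, hR₃⟩ : ∃ R₃ : ExteriorAlgebra ℤ M, R₃ = P₂ * h₄ + 2 * (P₂ * h₅) + 4 * (P * (h₄ * h₅)) :=
    ⟨_, rfl⟩
  obtain ⟨R₄, hR₄⟩ : ∃ R₄ : ExteriorAlgebra ℤ M, R₄ = P₃ * h₄ + 2 * (P₃ * h₅) + 4 * (P₂ * (h₄ * h₅)) :=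
    ⟨_, rfl⟩
  obtain ⟨E₂, hE₂⟩ : ∃ E₂ : ExteriorAlgebra ℤ M, E₂ = P₂ + 2 * R₂ := ⟨_, rfl⟩
  obtain ⟨E₃, hE₃⟩ : ∃ E₃ : ExteriorAlgebra ℤ M, E₃ = P₃ + 2 * R₃ := ⟨_, rfl⟩
  obtain ⟨E₄, hE₄⟩ : ∃ E₄ : ExteriorAlgebra ℤ M, E₄ = P₄ + 2 * R₄ := ⟨_, rfl⟩
  -- memberships in the commutative 2-vector subalgebra `Λ`
  have mh₀ : h₀ ∈ Λ := Algebra.subset_adjoin ⟨(x 0, x 1), hh₀.symm⟩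
  have mh₁ : h₁ ∈ Λ := Algebra.subset_adjoin ⟨(x 2, x 3), hh₁.symm⟩
  have mh₂ : h₂ ∈ Λ := Algebra.subset_adjoin ⟨(x 4, x 5), hh₂.symm⟩
  have mh₃ : h₃ ∈ Λ := Algebra.subset_adjoin ⟨(x 6, x 7), hh₃.symm⟩
  have mh₄ : h₄ ∈ Λ := Algebra.subset_adjoin ⟨(x 8, x 9), hh₄.symm⟩
  have mh₅ : h₅ ∈ Λ := Algebra.subset_adjoin ⟨(x 10, x 11), hh₅.symm⟩
  have mβ : β ∈ Λ := Algebra.subset_adjoin ⟨(a, b), hβ.symm⟩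
  have mXΛ : X ∈ Λ := Algebra.span_le_adjoin ℤ _ mX
  obtain ⟨X₂, mX₂, X₃, mX₃, qX, cX⟩ := exists_dividedPowers_of_mem_span X mX
  have mP : P ∈ Λ := by rw [hP]; exact Λ.add_mem (Λ.add_mem (Λ.add_mem mh₀ mh₁) mh₂) mh₃
  have mD : D ∈ Λ := by
    rw [hD, ← hP]
    exact Λ.add_mem (Λ.add_mem (Λ.mul_mem (Λ.natCast_mem 4) mP) (Λ.mul_mem (Λ.natCast_mem 8) mh₄))
      (Λ.mul_mem (Λ.natCast_mem 16) mh₅)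
  have mB : B ∈ Λ := by rw [hB]; exact Λ.add_mem mβ (Λ.mul_mem (Λ.natCast_mem 2) mXΛ)
  -- the slots and the leading digit square to zero (as equations in `Λ`)
  have q₀ : (⟨h₀, mh₀⟩ : Λ) * ⟨h₀, mh₀⟩ = 0 := Subtype.ext (by subst hh₀; exact twoVector_mul_self (x 0) (x 1))
  have q₁ : (⟨h₁, mh₁⟩ : Λ) * ⟨h₁, mh₁⟩ = 0 := Subtype.ext (by subst hh₁; exact twoVector_mul_self (x 2) (x 3))
  have q₂ : (⟨h₂, mh₂⟩ : Λ) * ⟨h₂, mh₂⟩ = 0 := Subtype.ext (by subst hh₂; exact twoVector_mul_self (x 4) (x 5))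
  have q₃ : (⟨h₃, mh₃⟩ : Λ) * ⟨h₃, mh₃⟩ = 0 := Subtype.ext (by subst hh₃; exact twoVector_mul_self (x 6) (x 7))
  have q₄ : (⟨h₄, mh₄⟩ : Λ) * ⟨h₄, mh₄⟩ = 0 := Subtype.ext (by subst hh₄; exact twoVector_mul_self (x 8) (x 9))
  have q₅ : (⟨h₅, mh₅⟩ : Λ) * ⟨h₅, mh₅⟩ = 0 :=
    Subtype.ext (by subst hh₅; exact twoVector_mul_self (x 10) (x 11))
  have qβ : (⟨β, mβ⟩ : Λ) * ⟨β, mβ⟩ = 0 := Subtype.ext (by subst hβ; exact ι₄_eq_zero_13 a b b)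
  -- (1) the divided powers of `D` are the closed forms: `D₂ = 16E₂`, `D₃ = 64E₃`, `D₄ = 256E₄`
  have hDΛ : (⟨D, mD⟩ : Λ) = 4 * (⟨h₀, mh₀⟩ + ⟨h₁, mh₁⟩ + ⟨h₂, mh₂⟩ + ⟨h₃, mh₃⟩) + 8 * ⟨h₄, mh₄⟩
      + 16 * ⟨h₅, mh₅⟩ := Subtype.ext (by push_cast; exact hD)
  have k₂ := congrArg Subtype.val (sq_D_c34 (R := Λ) _ _ _ _ _ _ _ hDΛ q₀ q₁ q₂ q₃ q₄ q₅)
  have k₂₃ := congrArg Subtype.val (D2_mul_D_c34 (R := Λ) _ _ _ _ _ _ _ hDΛ q₀ q₁ q₂ q₃ q₄ q₅)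
  have k₃₄ := congrArg Subtype.val (D3_mul_D_c34 (R := Λ) _ _ _ _ _ _ _ hDΛ q₀ q₁ q₂ q₃ q₄ q₅)
  push_cast at k₂ k₂₃ k₃₄
  simp only [val_ofNat] at k₂ k₂₃ k₃₄
  have eD₂ : D₂ = 16 * E₂ := by
    have k : D * D = 2 * (16 * E₂) := by rw [k₂, hE₂, hR₂, hP₂, hP]; noncomm_ring
    exact cancel_2 x (qD.symm.trans k)
  have eD₃ : D₃ = 64 * E₃ := by
    have k : D * D * D = 6 * (64 * E₃) := by
      calc D * D * D = 2 * (16 * E₂) * D := by rw [qD, eD₂]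
        _ = 2 * ((16 * (h₀ * h₁ + h₀ * h₂ + h₀ * h₃ + h₁ * h₂ + h₁ * h₃ + h₂ * h₃)
            + 32 * ((h₀ + h₁ + h₂ + h₃) * h₄) + 64 * ((h₀ + h₁ + h₂ + h₃) * h₅) + 128 * (h₄ * h₅)) * D) := by
          rw [hE₂, hR₂, hP₂, hP]; noncomm_ring
        _ = 6 * (64 * E₃) := by rw [k₂₃, hE₃, hR₃, hP₃, hP₂, hP]; noncomm_ring
    exact cancel_6 x (cD.symm.trans k)
  have eD₄ : D₄ = 256 * E₄ := by
    have k : D * D * D * D = 24 * (256 * E₄) := by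
      calc D * D * D * D = 6 * (64 * E₃) * D := by rw [cD, eD₃]
        _ = 6 * ((64 * (h₀ * h₁ * h₂ + h₀ * h₁ * h₃ + h₀ * h₂ * h₃ + h₁ * h₂ * h₃)
            + 128 * ((h₀ * h₁ + h₀ * h₂ + h₀ * h₃ + h₁ * h₂ + h₁ * h₃ + h₂ * h₃) * h₄)
            + 256 * ((h₀ * h₁ + h₀ * h₂ + h₀ * h₃ + h₁ * h₂ + h₁ * h₃ + h₂ * h₃) * h₅)
            + 512 * ((h₀ + h₁ + h₂ + h₃) * (h₄ * h₅))) * D) := by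
          rw [hE₃, hR₃, hP₃, hP₂, hP]; noncomm_ring
        _ = 24 * (256 * E₄) := by rw [k₃₄, hE₄, hR₄, hP₄, hP₃, hP₂]; noncomm_ring
    exact cancel_24 x (fD.symm.trans k)
  -- (2) the divided powers of `B = β + 2X`: `B₂ = 2βX + 4X₂`, `B₃ = 4βX₂ + 8X₃`, `3B₄ = 8(βXX₂ + X₂X₂)`
  have hBΛ : (⟨B, mB⟩ : Λ) = ⟨β, mβ⟩ + 2 * ⟨X, mXΛ⟩ := Subtype.ext (by push_cast; exact hB)
  have qβ' : (⟨β, mβ⟩ : Λ) * ⟨β, mβ⟩ = 2 * 0 := by rw [mul_zero]; exact qβ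
  have cβ' : (⟨β, mβ⟩ : Λ) * ⟨β, mβ⟩ * ⟨β, mβ⟩ = 6 * 0 := by rw [qβ, zero_mul, mul_zero]
  have qXΛ : (⟨X, mXΛ⟩ : Λ) * ⟨X, mXΛ⟩ = 2 * ⟨X₂, mX₂⟩ := Subtype.ext (by push_cast; exact qX)
  have cXΛ : (⟨X, mXΛ⟩ : Λ) * ⟨X, mXΛ⟩ * ⟨X, mXΛ⟩ = 6 * ⟨X₃, mX₃⟩ := Subtype.ext (by push_cast; exact cX)
  have eB₂ : B₂ = 2 * (β * X) + 4 * X₂ := by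
    have k := congrArg Subtype.val (sq_shift_two (R := Λ) _ _ _ _ _ hBΛ qβ' qXΛ)
    push_cast at k
    simp only [val_ofNat] at k
    have k' : B * B = 2 * (2 * (β * X) + 4 * X₂) := by rw [k]; noncomm_ring
    exact cancel_2 x (qB.symm.trans k')
  have eB₃ : B₃ = 4 * (β * X₂) + 8 * X₃ := by
    have k := congrArg Subtype.val (cube_shift_two (R := Λ) _ _ _ _ _ _ _ hBΛ qβ' cβ' qXΛ cXΛ)
    push_cast at k
    simp only [val_ofNat] at k
    have k' : B * B * B = 6 * (4 * (β * X₂) + 8 * X₃) := by rw [k]; noncomm_ring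
    exact cancel_6 x (cB.symm.trans k')
  obtain ⟨Y, hY⟩ : ∃ Y : ExteriorAlgebra ℤ M, Y = β * X * X₂ + X₂ * X₂ := ⟨_, rfl⟩
  have e16 : (2 * (β * X) + 4 * X₂) * (2 * (β * X) + 4 * X₂) = 16 * Y := by
    have k := congrArg Subtype.val (sq_halfSquare (R := Λ) ⟨β, mβ⟩ ⟨X, mXΛ⟩ ⟨X₂, mX₂⟩ qβ)
    push_cast at k
    simp only [val_ofNat] at k
    rw [k, hY]
  have e3B₄ : 3 * B₄ = 8 * Y := by
    have k : (24 : ExteriorAlgebra ℤ M) * B₄ = 8 * (8 * Y) := by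
      rw [← fB]
      calc B * B * B * B = (B * B) * (B * B) := by noncomm_ring
        _ = 4 * ((2 * (β * X) + 4 * X₂) * (2 * (β * X) + 4 * X₂)) := by rw [qB, eB₂]; noncomm_ring
        _ = 8 * (8 * Y) := by rw [e16]; noncomm_ring
    have k' : (8 : ExteriorAlgebra ℤ M) * (3 * B₄) = 8 * (8 * Y) := by rw [← k]; noncomm_ring
    exact cancel_8 x k'
  have e256 : (256 : ExteriorAlgebra ℤ M) * σ₀ * B₄ = 2048 * (σ₀ * (3 * Y - B₄)) := by
    calc (256 : ExteriorAlgebra ℤ M) * σ₀ * B₄ = σ₀ * (768 * (3 * B₄) - 2048 * B₄) := by noncomm_ring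
      _ = σ₀ * (768 * (8 * Y) - 2048 * B₄) := by rw [e3B₄]
      _ = 2048 * (σ₀ * (3 * Y - B₄)) := by noncomm_ring
  -- (3) CRITERION L at `k = 3`: `T₃ = −128·P₂β + 256·(…)`, so `P₂β = 2W`
  obtain ⟨W₃, hW₃⟩ : ∃ W₃ : ExteriorAlgebra ℤ M, W₃ = u * E₃ - t * (E₂ * β) - 2 * (t * (E₂ * X)) - E₂ * X
    - σ₀ * (β * X₂) - 2 * (σ₀ * X₃) := ⟨_, rfl⟩
  have key₃ : T₃ = -128 * (E₂ * β) + 256 * W₃ := by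
    rw [hT₃, hσ₃, hσ₂, hσ₁, eD₃, eD₂, eB₃, hB, hW₃]; noncomm_ring
  have h128 : (128 : ExteriorAlgebra ℤ M) * (P₂ * β) = 128 * (2 * (W₃ - R₂ * β - 4 * Z₃)) := by
    have e : (1024 : ExteriorAlgebra ℤ M) * Z₃ = -128 * (E₂ * β) + 256 * W₃ := hcrit₃.symm.trans key₃
    rw [hE₂] at e
    calc (128 : ExteriorAlgebra ℤ M) * (P₂ * β)
        = 256 * W₃ - 256 * (R₂ * β) - (-128 * ((P₂ + 2 * R₂) * β) + 256 * W₃) := by noncomm_ring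
      _ = 256 * W₃ - 256 * (R₂ * β) - 1024 * Z₃ := by rw [← e]
      _ = 128 * (2 * (W₃ - R₂ * β - 4 * Z₃)) := by noncomm_ring
  have hdig := cancel_128 x h128
  obtain ⟨W, hW⟩ : ∃ W : ExteriorAlgebra ℤ M, W = W₃ - R₂ * β - 4 * Z₃ := ⟨_, rfl⟩
  rw [← hW] at hdig
  -- (4) `3P₃ = P·P₂`, so `u·P₃β` is even as well
  have ePP₂ : P * P₂ = 3 * P₃ := by
    have k := congrArg Subtype.val (P_mul_P2_four (R := Λ) ⟨h₀, mh₀⟩ ⟨h₁, mh₁⟩ ⟨h₂, mh₂⟩ ⟨h₃, mh₃⟩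
      q₀ q₁ q₂ q₃)
    push_cast at k
    simp only [val_ofNat] at k
    rw [hP, hP₂, hP₃]; exact k
  have hP₃β : (3 : ExteriorAlgebra ℤ M) * (P₃ * β) = 2 * (P * W) := by
    calc (3 : ExteriorAlgebra ℤ M) * (P₃ * β) = 3 * P₃ * β := by noncomm_ring
      _ = P * (P₂ * β) := by rw [← ePP₂]; noncomm_ring
      _ = 2 * (P * W) := by rw [hdig]; noncomm_ring
  have hu : u * (P₃ * β) = 2 * (u * (P * W - P₃ * β)) := by
    calc u * (P₃ * β) = u * (3 * (P₃ * β)) - 2 * (u * (P₃ * β)) := by noncomm_ring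
      _ = u * (2 * (P * W)) - 2 * (u * (P₃ * β)) := by rw [hP₃β]
      _ = 2 * (u * (P * W - P₃ * β)) := by noncomm_ring
  -- (5) CRITERION L at `k = 4`: `T₄ = 1024·P₄ + 2048·V`
  obtain ⟨W₄, hW₄⟩ : ∃ W₄ : ExteriorAlgebra ℤ M,
    W₄ = w * E₄ - u * (E₃ * X) + t * (E₂ * (β * X) + 2 * (E₂ * X₂)) + E₂ * X₂ := ⟨_, rfl⟩
  have key₄ : T₄ = 1024 * E₄ - 1024 * (u * (E₃ * β)) + 1024 * (E₂ * (β * X)) + 256 * σ₀ * B₄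
      + 2048 * W₄ := by
    rw [hT₄, hσ₄, hσ₃, hσ₂, hσ₁, eD₄, eD₃, eD₂, eB₂, hB, hW₄]; noncomm_ring
  have s₁ : u * (E₃ * β) = u * (P₃ * β) + 2 * (u * (R₃ * β)) := by rw [hE₃]; noncomm_ring
  have s₂ : E₂ * (β * X) = P₂ * β * X + 2 * (R₂ * (β * X)) := by rw [hE₂]; noncomm_ring
  obtain ⟨V, hV⟩ : ∃ V : ExteriorAlgebra ℤ M, V = R₄ - u * (P * W - P₃ * β) - u * (R₃ * β) + W * X
    + R₂ * (β * X) + σ₀ * (3 * Y - B₄) + W₄ := ⟨_, rfl⟩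
  have final₄ : T₄ = 1024 * P₄ + 2048 * V := by
    rw [key₄, s₁, s₂, hE₄, hu, hdig, e256, hV]; noncomm_ring
  -- (6) cancel `1024` and read the coefficient of `x₀ ∧ ⋯ ∧ x₇`
  have h1024 : (1024 : ExteriorAlgebra ℤ M) * P₄ = 1024 * (2 * (8 * Z₄ - V)) := by
    have e : (16384 : ExteriorAlgebra ℤ M) * Z₄ = 1024 * P₄ + 2048 * V := hcrit₄.symm.trans final₄
    calc (1024 : ExteriorAlgebra ℤ M) * P₄ = 1024 * P₄ + 2048 * V - 2048 * V := by noncomm_ring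
      _ = 16384 * Z₄ - 2048 * V := by rw [← e]
      _ = 1024 * (2 * (8 * Z₄ - V)) := by noncomm_ring
  have hP₄even := cancel_1024 x h1024
  rw [hP₄, hh₀, hh₁, hh₂, hh₃] at hP₄even
  exact P4_ne_two_mul x _ hP₄even

end DimZero

end Summit.Ventures.HSemireg.DimZeroUnitsClassDead
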